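import Mathlib
import Summits.ValiantsHypothesis.ValiantsHypothesis.Theorems.RigidityForcesSymmetryRankRigidMinimalReprLaplaceFiveStarT1NormalForm

/-!
# ValiantsHypothesis / RigidityForcesSymmetry — crux `LaplaceOptimalFive` (stmt-ValiantsHypothesis-24813), crux idea
`young-shadow` (K1) on the star: **THE T1 SLACK IS `E ∝ β·L·PᵀQP` (explicit expansion, integer-scaled)**
(memo `NOTE-p4g15-24813-K1-star.md` §4 «`E = H − Hess f` is the displayed matrix (direct expansion)», §10 SETTING)

After ✓ `t1_normal_form`, a T1 two-term tensor in the basis `(L², Q)` has cubics `k₁ = L(C a₁ L² + C b₁ Q)`, `k₂ = C a₂ L³` with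
`2b₁ = 3a₂`.  Its cubic matrix is `C_{ab} = λ_aλ_b k₁ + Q_{ab} k₂`, its quintic is `f = (L² k₁ + Q k₂)/20`, and the SLACK
`E_{ab} = C_{ab} − ∂_a∂_b f` satisfies, entry by entry and cleared of denominators (`t1_slack_entry`):

  `40·C_{ab} − 2·∂_a∂_b(L²k₁ + Qk₂) = 15 a₂ · L · ( 2L²·Q_{ab} − L·(λ_a ∂_bQ + λ_b ∂_aQ) + 2λ_aλ_b·Q )`,

i.e. `E = (3β/4)·ℓ·PᵀQP` with `β = a₂`, `P = ℓI − yλᵀ` (`∂_bQ = 2(Qy)_b`).  Consequences: `L` divides every slack entry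
(`t1_slack_dvd`) and `E_{ab} ≡ (3β/4)λ_aλ_b·L·Q (mod L²)` (`t1_slack_mod_sq`; «`E/ℓ` at `ℓ = 0` is `∝ β q̄ λλᵀ`», the uniqueness-of-`ℓ`
handle).  No definitions, no `sorry`.  Honest framing: helper for (L3-iii)/(L1); K1-on-the-star PAPER PASS, not kernel;
`LaplaceOptimalFive` OPEN · CONTESTED 72/120; `VP ≠ VNP` NOT proved.
-/

set_option linter.dupNamespace false

namespace Summit.ValiantsHypothesis.ValiantsHypothesis.Theorems.RigidityForcesSymmetryRankRigidMinimalRepr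

namespace LaplaceFiveStar

open Finset MvPolynomial

/-- **T1 slack, entry by entry (×40).**  `L = Σ λ_z X_z`, any `Q` with `∂_a∂_bQ = 2·C qab`, `k₁ = L(C a₁L² + C b₁Q)`, `k₂ = C a₂ L³`,
`2b₁ = 3a₂`:  `40(C(λ_aλ_b)k₁ + C qab·k₂) − 2∂_a∂_b(L²k₁ + Qk₂) = 15·C a₂·L·(2L²·C qab − L(Cλ_a ∂_bQ + Cλ_b ∂_aQ) + 2C(λ_aλ_b)Q)`.
[folklore] -/
theorem t1_slack_entry (lam : Fin 5 → ℂ) (Q : MvPolynomial (Fin 5) ℂ) (a₁ b₁ a₂ : ℂ) (hrel : 2 * b₁ = 3 * a₂)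
    (a b : Fin 5) (qab : ℂ) (hQ2 : pderiv a (pderiv b Q) = 2 * C qab) :
    let L : MvPolynomial (Fin 5) ℂ := ∑ z : Fin 5, lam z • (X z : MvPolynomial (Fin 5) ℂ)
    let k₁ : MvPolynomial (Fin 5) ℂ := L * (C a₁ * L ^ 2 + C b₁ * Q)
    let k₂ : MvPolynomial (Fin 5) ℂ := C a₂ * L ^ 3
    40 * (C (lam a * lam b) * k₁ + C qab * k₂) - 2 * pderiv a (pderiv b (L ^ 2 * k₁ + Q * k₂))
      = 15 * C a₂ * L * (2 * L ^ 2 * C qab - L * (C (lam a) * pderiv b Q + C (lam b) * pderiv a Q)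
        + 2 * C (lam a * lam b) * Q) := by
  classical
  intro L k₁ k₂
  have hLx : ∀ x : Fin 5, pderiv x L = C (lam x) := fun x => pderiv_sum_smul_X lam x
  have hrelC : (2 : MvPolynomial (Fin 5) ℂ) * C b₁ = 3 * C a₂ := by
    have h := congr_arg (C : ℂ → MvPolynomial (Fin 5) ℂ) hrel
    simp only [map_mul, map_ofNat] at h
    exact h
  simp only [k₁, k₂, pderiv_mul, pderiv_C, Derivation.leibniz_pow, Derivation.map_natCast, hLx, map_add, map_mul,
    smul_eq_mul, nsmul_eq_mul, zero_mul, mul_zero, zero_add, add_zero, hQ2]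
  linear_combination (14 * (C (lam a) * C (lam b)) * L * Q - 3 * L ^ 2 * (C (lam a) * pderiv b Q + C (lam b) * pderiv a Q)
    - 2 * L ^ 3 * C qab) * hrelC

/-- The slack entries are divisible by `L`. [folklore] -/
theorem t1_slack_dvd (lam : Fin 5 → ℂ) (Q : MvPolynomial (Fin 5) ℂ) (a₂ : ℂ) (a b : Fin 5) (qab : ℂ) :
    let L : MvPolynomial (Fin 5) ℂ := ∑ z : Fin 5, lam z • (X z : MvPolynomial (Fin 5) ℂ)
    L ∣ 15 * C a₂ * L * (2 * L ^ 2 * C qab - L * (C (lam a) * pderiv b Q + C (lam b) * pderiv a Q)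
        + 2 * C (lam a * lam b) * Q) := by
  intro L
  exact ⟨15 * C a₂ * (2 * L ^ 2 * C qab - L * (C (lam a) * pderiv b Q + C (lam b) * pderiv a Q)
    + 2 * C (lam a * lam b) * Q), by ring⟩

/-- Modulo `L²` the (×40) slack entry is `30·C(a₂λ_aλ_b)·L·Q` («`E/ℓ` at `ℓ = 0` is `∝ β q̄ λλᵀ`»). [folklore] -/
theorem t1_slack_mod_sq (lam : Fin 5 → ℂ) (Q : MvPolynomial (Fin 5) ℂ) (a₂ : ℂ) (a b : Fin 5) (qab : ℂ) :
    let L : MvPolynomial (Fin 5) ℂ := ∑ z : Fin 5, lam z • (X z : MvPolynomial (Fin 5) ℂ)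
    L ^ 2 ∣ 15 * C a₂ * L * (2 * L ^ 2 * C qab - L * (C (lam a) * pderiv b Q + C (lam b) * pderiv a Q)
        + 2 * C (lam a * lam b) * Q) - 30 * C (a₂ * (lam a * lam b)) * L * Q := by
  intro L
  exact ⟨15 * C a₂ * (2 * L * C qab - (C (lam a) * pderiv b Q + C (lam b) * pderiv a Q)), by
    simp only [map_mul]; ring⟩

end LaplaceFiveStar

end Summit.ValiantsHypothesis.ValiantsHypothesis.Theorems.RigidityForcesSymmetryRankRigidMinimalRepr
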